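import Literature.Topology.FourManifolds.ConcordanceStripReplacement
import Literature.Topology.FourManifolds.GluckTwistTransport
import Mathlib.Analysis.SpecialFunctions.SmoothTransition
import HarnessLib

/-!
# Splicing the trace of an ambient isotopy into the lower cone of a conical concordance

Topic `Literature/Topology/FourManifolds`; preparatory step of the proof programme of the
Fox–Milnor fact `Literature.Topology.FourManifolds.Knot.exists_isConnectedSum_isConcordant`
(the end knots of a conical concordance are moved, within their isotopy classes, into flat-arc
position before the concordance is read in the stereographic chart). Everything here is proved;
no named fact is introduced.

Given a conical concordance `f` from `K` to `K'` (`Knot.IsConicalConcordance K K' f δ`) and an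
ambient isotopy `F` of `𝕊³`, **the lower cone `t • K x`, `t ≤ 1 + ε`, is replaced by the trace
`t • F_{λ(t)} (K x)`** of the isotopy run backwards along the radius (`λ = 1` for
`t ≤ 1 + ε/2`, `λ = 0` for `t ≥ 1 + ε`), for a width `ε ≤ δ/2` below the margin of the middle
levels (`exists_lower_margin`): the result (`spliceLift`, descended to `𝕊¹ × ℝ` by
`StripFrame.descend`) is a conical concordance of width `ε/2` from the moved knot
`K.map (F.toDiffeomorph 1)` to `K'` (`IsConicalConcordance.exists_splice_bottom`). The trace is
embedded because its levels are the radii (each stage of `F` is injective) and an immersion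
because it is a cone over a moving regular unit curve (`injective_fderiv_cone_family`); it does
not meet the rest of the annulus, whose radii are larger.

## References

* R. H. Fox, J. W. Milnor, *Singularities of 2-spheres in 4-space and cobordism of knots*, Osaka
  J. Math. 3 (1966), §1. [FoxMilnor1966]
* M. W. Hirsch, *Differential Topology*, GTM 33 (1976), Ch. 8 §1 (isotopy, traces). [HirschDT1976]

## Design notes

No named facts, no `sorry`; `𝔼 n`, `𝕊 n`, `𝓘₁₁` are local notation as in
`ConcordanceStripReplacement.lean`.
-/

open scoped Manifold Topology ContDiff RealInnerProductSpace
open Function Set Metric Filter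

noncomputable section

namespace Literature.Topology.FourManifolds

/-- Local notation: `𝔼 n` is the model Euclidean space `EuclideanSpace ℝ (Fin n)`. -/
local notation "𝔼 " n:arg => EuclideanSpace ℝ (Fin n)

/-- Local notation: `𝕊 n` is the unit sphere in `EuclideanSpace ℝ (Fin (n + 1))`. -/
local notation "𝕊 " n:arg => (Metric.sphere (0 : EuclideanSpace ℝ (Fin (n + 1))) 1)

/-- Local notation for the model with corners of `𝕊 1 × ℝ`. -/
local notation "𝓘₁₁" => (ModelWithCorners.prod (𝓡 1) 𝓘(ℝ, ℝ))

attribute [local instance] fact_finrank_euclideanSpace_succ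

namespace Knot

open StripFrame

/-! ### The transition function of the splice -/

/-- The transition `λ_ε t = smoothTransition ((1 + ε - t) / (ε/2))`: `1` for `t ≤ 1 + ε/2`, `0`
for `t ≥ 1 + ε`. [folklore] -/
def spliceFn (ε t : ℝ) : ℝ := Real.smoothTransition ((1 + ε - t) / (ε / 2))

/-- The transition is `C^∞` in `t`. [folklore] -/
theorem contDiff_spliceFn (ε : ℝ) : ContDiff ℝ ∞ (spliceFn ε) :=
  Real.smoothTransition.contDiff.comp ((contDiff_const.sub contDiff_id).div_const _)

/-- `λ_ε t = 1` for `t ≤ 1 + ε/2` (`ε > 0`). [folklore] -/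
theorem spliceFn_of_le {ε t : ℝ} (hε : 0 < ε) (ht : t ≤ 1 + ε / 2) : spliceFn ε t = 1 := by
  rw [spliceFn, Real.smoothTransition.one_of_one_le]
  rw [le_div_iff₀ (by positivity)]; linarith

/-- `λ_ε t = 0` for `t ≥ 1 + ε` (`ε > 0`). [folklore] -/
theorem spliceFn_of_ge {ε t : ℝ} (hε : 0 < ε) (ht : 1 + ε ≤ t) : spliceFn ε t = 0 := by
  rw [spliceFn, Real.smoothTransition.zero_of_nonpos]
  exact div_nonpos_of_nonpos_of_nonneg (by linarith) (by positivity)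

/-! ### Cones over moving regular unit curves are immersions -/

/-- **A cone over a moving regular unit curve is an immersion**: if `P : ℝ × ℝ → ℝ⁴` is `C¹`
with `‖P‖ = 1` and nonvanishing `θ`-derivative, then `(θ, t) ↦ t • P (θ, t)` has injective
differential wherever `t ≠ 0`. [folklore] -/
theorem injective_fderiv_cone_family {P : ℝ × ℝ → 𝔼 4} (hP : ContDiff ℝ 1 P)
    (hn : ∀ q, ‖P q‖ = 1) {q : ℝ × ℝ} (hθ : fderiv ℝ P q (1, 0) ≠ 0) (ht : q.2 ≠ 0) :
    Injective (fderiv ℝ (fun q : ℝ × ℝ ↦ q.2 • P q) q) := by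
  have hPd : Differentiable ℝ P := hP.differentiable (by simp)
  have hF : HasFDerivAt (fun q : ℝ × ℝ ↦ q.2 • P q)
      (q.2 • fderiv ℝ P q + (ContinuousLinearMap.snd ℝ ℝ ℝ).smulRight (P q)) q :=
    (hasFDerivAt_snd (𝕜 := ℝ) (E := ℝ) (F := ℝ) (p := q)).smul (hPd q).hasFDerivAt
  rw [hF.fderiv]
  -- the two partial derivatives are orthogonal to `P q`
  have horth : ∀ v : ℝ × ℝ, ⟪P q, fderiv ℝ P q v⟫ = 0 := by
    intro v
    -- along the line `s ↦ q + s • v` the curve `P` is a unit curve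
    set k : ℝ → 𝔼 4 := fun s ↦ P (q + s • v) with hk
    have hkd : Differentiable ℝ k := hPd.comp ((differentiable_const _).add (differentiable_id.smul_const v))
    have h0 := inner_deriv_eq_zero_of_norm_eq_one hkd (fun s ↦ hn _) 0
    have hderiv : deriv k 0 = fderiv ℝ P q v := by
      have hl : HasDerivAt (fun s : ℝ ↦ q + s • v) v 0 := by
        simpa using ((hasDerivAt_id (0 : ℝ)).smul_const v).const_add q
      have := (hPd (q + (0 : ℝ) • v)).hasFDerivAt.comp_hasDerivAt (0 : ℝ) hl
      simp only [zero_smul, add_zero] at this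
      exact this.deriv
    rw [← hderiv]
    simpa [hk] using h0
  refine (injective_iff_map_eq_zero _).2 fun v hv ↦ ?_
  have hv' : q.2 • fderiv ℝ P q v + v.2 • P q = 0 := by
    simpa [ContinuousLinearMap.smulRight_apply] using hv
  clear hv
  have hv := hv'
  -- pair with `P q`: `v.2 = 0`
  have h2 : v.2 = 0 := by
    have := congrArg (fun w ↦ ⟪P q, w⟫) hv
    simp only [inner_add_right, real_inner_smul_right, horth v, mul_zero, zero_add,
      real_inner_self_eq_norm_sq, hn q, one_pow, mul_one, inner_zero_right] at this
    exact this
  rw [h2, zero_smul, add_zero] at hv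
  have h1 : fderiv ℝ P q v = 0 := by
    rcases smul_eq_zero.1 hv with h | h
    · exact absurd h ht
    · exact h
  have hvv : v = v.1 • ((1, 0) : ℝ × ℝ) := by ext <;> simp [h2]
  rw [hvv, map_smul, smul_eq_zero] at h1
  rcases h1 with h1 | h1
  · rw [hvv, h1, zero_smul]
  · exact absurd h1 hθ

namespace IsConicalConcordance

variable {K K' : Knot} {f : (𝕊 1) × ℝ → 𝔼 4} {δ : ℝ} (h : IsConicalConcordance K K' f δ)
include h

/-! ### The margin of the middle levels -/

/-- **The lower margin of the middle**: on `[1 + δ, 2 - δ]` the radius is at least `1 + m` for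
some `m > 0` (compactness). [folklore] -/
theorem exists_lower_margin : ∃ m : ℝ, 0 < m ∧ ∀ θ, ∀ t ∈ Icc (1 + δ) (2 - δ),
    1 + m ≤ ‖annulusLift f (θ, t)‖ := by
  have hδ := h.δ_pos
  have hδ4 := h.δ_le
  have hKc : IsCompact (Icc (0 : ℝ) 1 ×ˢ Icc (1 + δ) (2 - δ)) := isCompact_Icc.prod isCompact_Icc
  have hne : (Icc (0 : ℝ) 1 ×ˢ Icc (1 + δ) (2 - δ)).Nonempty :=
    ⟨(0, 3 / 2), ⟨⟨le_rfl, zero_le_one⟩, ⟨by linarith, by linarith⟩⟩⟩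
  have hc : Continuous fun p : ℝ × ℝ ↦ ‖annulusLift f p‖ :=
    (contDiff_annulusLift h.isConcordance.1).continuous.norm
  obtain ⟨p₁, hp₁, hmin⟩ := hKc.exists_isMinOn hne hc.continuousOn
  rw [isMinOn_iff] at hmin
  have hp₁' := mem_prod.1 hp₁
  have h1 : 1 < ‖annulusLift f p₁‖ := by
    rw [show p₁ = (p₁.1, p₁.2) from rfl, annulusLift_apply]
    exact (h.isConcordance.2.2.2.1 _ _ ⟨by linarith [hp₁'.2.1], by linarith [hp₁'.2.2]⟩).1
  refine ⟨‖annulusLift f p₁‖ - 1, by linarith, fun θ t ht ↦ ?_⟩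
  have hper : annulusLift f (θ, t) = annulusLift f (Int.fract θ, t) := by
    have := annulusLift_add_int f (Int.fract θ) t ⌊θ⌋
    rw [show Int.fract θ + (⌊θ⌋ : ℝ) = θ from Int.fract_add_floor θ] at this
    exact this
  rw [hper]
  have := hmin (Int.fract θ, t) (mem_prod.2 ⟨⟨Int.fract_nonneg θ, (Int.fract_lt_one θ).le⟩, ht⟩)
  linarith

/-! ### The spliced lift -/

variable (F : AmbientIsotopy (𝓡 3) (𝕊 3))

/-- The moving unit curve `P (θ, t) = F_{λ_ε t} (K (circlePt θ))` read in `ℝ⁴`. [folklore] -/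
def movingCurve (_ : IsConicalConcordance K K' f δ) (ε : ℝ) (q : ℝ × ℝ) : 𝔼 4 :=
  ((F.toFun (spliceFn ε q.2) (K (circlePt q.1)) : 𝕊 3) : 𝔼 4)

/-- The moving curve is `C^∞`. [folklore] -/
theorem contDiff_movingCurve (ε : ℝ) : ContDiff ℝ ∞ (h.movingCurve F ε) := by
  have h1 : ContMDiff (𝓘(ℝ, ℝ).prod 𝓘(ℝ, ℝ)) (𝓡 3) ∞
      fun q : ℝ × ℝ ↦ F.toFun (spliceFn ε q.2) (K (circlePt q.1)) :=
    F.contMDiff.comp (((contDiff_spliceFn ε).contMDiff.comp contMDiff_snd).prodMk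
      ((K.contMDiff.comp contMDiff_circlePt).comp contMDiff_fst))
  have h2 : ContMDiff (𝓘(ℝ, ℝ).prod 𝓘(ℝ, ℝ)) 𝓘(ℝ, 𝔼 4) ∞ (h.movingCurve F ε) :=
    contMDiff_coe_sphere.comp h1
  rw [← contMDiff_iff_contDiff]
  rw [modelWithCornersSelf_prod, ← chartedSpaceSelf_prod]
  exact h2

/-- The moving curve is a unit curve. [folklore] -/
theorem norm_movingCurve (ε : ℝ) (q : ℝ × ℝ) : ‖h.movingCurve F ε q‖ = 1 := norm_eq_of_mem_sphere _

/-- At fixed `t` the moving curve is the curve of the moved knot. [folklore] -/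
theorem movingCurve_eq_curve (ε θ t : ℝ) :
    h.movingCurve F ε (θ, t) = Knot.curve (K.map (F.toDiffeomorph (spliceFn ε t))) θ := rfl

/-- The `θ`-derivative of the moving curve does not vanish. [folklore] -/
theorem fderiv_movingCurve_ne_zero (ε : ℝ) (q : ℝ × ℝ) : fderiv ℝ (h.movingCurve F ε) q (1, 0) ≠ 0 := by
  have hd : fderiv ℝ (h.movingCurve F ε) q (1, 0) =
      deriv (Knot.curve (K.map (F.toDiffeomorph (spliceFn ε q.2)))) q.1 := by
    have hc : HasDerivAt (fun θ : ℝ ↦ (θ, q.2)) ((1, 0) : ℝ × ℝ) q.1 :=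
      (hasDerivAt_id q.1).prodMk (hasDerivAt_const q.1 q.2)
    have := (((h.contDiff_movingCurve F ε).differentiable (by simp)) q).hasFDerivAt.comp_hasDerivAt
      q.1 hc
    have hfun : (h.movingCurve F ε ∘ fun θ : ℝ ↦ (θ, q.2)) =
        Knot.curve (K.map (F.toDiffeomorph (spliceFn ε q.2))) := rfl
    rw [hfun] at this
    exact this.deriv.symm
  rw [hd]
  exact Knot.deriv_curve_ne_zero _ _

/-- The moving curve is periodic in `θ`. [folklore] -/
theorem movingCurve_add_one (ε θ t : ℝ) : h.movingCurve F ε (θ + 1, t) = h.movingCurve F ε (θ, t) := by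
  simp [movingCurve, circlePt_add_one]

/-- **The spliced lift**: the trace cone `t • F_{λ_ε t} (K x)` for `t ≤ 1 + ε`, the old annulus
above. [folklore] -/
def spliceLift (ε : ℝ) (q : ℝ × ℝ) : 𝔼 4 :=
  if q.2 ≤ 1 + ε then q.2 • h.movingCurve F ε q else annulusLift f q

/-- The trace part. [folklore] -/
theorem spliceLift_of_le {ε : ℝ} {q : ℝ × ℝ} (hq : q.2 ≤ 1 + ε) :
    h.spliceLift F ε q = q.2 • h.movingCurve F ε q := if_pos hq

/-- The old part. [folklore] -/
theorem spliceLift_of_gt {ε : ℝ} {q : ℝ × ℝ} (hq : 1 + ε < q.2) :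
    h.spliceLift F ε q = annulusLift f q := if_neg (not_le.2 hq)

/-- Below `1 + δ` the spliced lift is the trace cone (the old cone is the trace at `λ = 0`),
for `0 < ε ≤ δ`. [folklore] -/
theorem spliceLift_of_le_delta {ε : ℝ} (hε : 0 < ε) {q : ℝ × ℝ} (hq : q.2 ≤ 1 + δ) :
    h.spliceLift F ε q = q.2 • h.movingCurve F ε q := by
  rcases le_or_gt q.2 (1 + ε) with h1 | h1
  · exact h.spliceLift_of_le F h1
  · rw [h.spliceLift_of_gt F h1, show q = (q.1, q.2) from rfl, annulusLift_apply, h.cone₁ _ _ hq,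
      movingCurve, spliceFn_of_ge hε h1.le, F.map_zero]
    rfl

/-- The spliced lift is `1`-periodic in `θ`. [folklore] -/
theorem spliceLift_add_one (ε θ t : ℝ) : h.spliceLift F ε (θ + 1, t) = h.spliceLift F ε (θ, t) := by
  by_cases ht : t ≤ 1 + ε
  · rw [h.spliceLift_of_le F (q := (θ + 1, t)) ht, h.spliceLift_of_le F (q := (θ, t)) ht,
      h.movingCurve_add_one]
  · push Not at ht
    rw [h.spliceLift_of_gt F (q := (θ + 1, t)) ht, h.spliceLift_of_gt F (q := (θ, t)) ht]
    exact_mod_cast annulusLift_add_int f θ t 1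

/-- **The spliced lift is `C^∞`** (for `0 < ε < δ`): it is the trace cone on `{t < 1 + δ}` and
the old lift on `{t > 1 + ε}`. [folklore] -/
theorem contDiff_spliceLift {ε : ℝ} (hε : 0 < ε) (hεδ : ε < δ) : ContDiff ℝ ∞ (h.spliceLift F ε) := by
  have hb : ContDiff ℝ ∞ fun q : ℝ × ℝ ↦ q.2 • h.movingCurve F ε q :=
    contDiff_snd.smul (h.contDiff_movingCurve F ε)
  have hl : ContDiff ℝ ∞ (annulusLift f) := contDiff_annulusLift h.isConcordance.1
  rw [contDiff_iff_contDiffAt]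
  intro q
  rcases lt_or_ge q.2 (1 + δ) with h1 | h1
  · refine hb.contDiffAt.congr_of_eventuallyEq ?_
    filter_upwards [(isOpen_lt continuous_snd continuous_const).mem_nhds h1] with q' hq'
    exact h.spliceLift_of_le_delta F hε (le_of_lt hq')
  · refine hl.contDiffAt.congr_of_eventuallyEq ?_
    filter_upwards [(isOpen_lt continuous_const continuous_snd).mem_nhds
      (show 1 + ε < q.2 by linarith)] with q' hq'
    exact h.spliceLift_of_gt F hq'

/-- The radius of the trace part is the parameter. [folklore] -/
theorem norm_spliceLift_of_le {ε : ℝ} {q : ℝ × ℝ} (hq : q.2 ≤ 1 + ε) (hq0 : 0 ≤ q.2) :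
    ‖h.spliceLift F ε q‖ = q.2 := by
  rw [h.spliceLift_of_le F hq, norm_smul, h.norm_movingCurve, mul_one, Real.norm_eq_abs, abs_of_nonneg hq0]

/-- **The radii of the old part above `1 + ε` exceed `1 + ε`** when `ε ≤ δ/2` is below the
lower margin. [folklore] -/
theorem lt_norm_annulusLift {ε m : ℝ} (hε : 0 < ε) (hεm : ε < m)
    (hm : ∀ θ, ∀ t ∈ Icc (1 + δ) (2 - δ), 1 + m ≤ ‖annulusLift f (θ, t)‖)
    {θ t : ℝ} (ht : 1 + ε < t) : 1 + ε < ‖annulusLift f (θ, t)‖ := by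
  have hδ := h.δ_pos
  have hδ4 := h.δ_le
  rcases le_or_gt t (1 + δ) with h1 | h1
  · rw [annulusLift_apply, h.cone₁ _ _ h1, norm_smul, norm_eq_of_mem_sphere, mul_one, Real.norm_eq_abs,
      abs_of_pos (by linarith)]
    exact ht
  rcases lt_or_ge t (2 - δ) with h2 | h2
  · have := hm θ t ⟨h1.le, h2.le⟩; linarith
  · rw [annulusLift_apply, h.cone₂ _ _ h2, norm_smul, norm_eq_of_mem_sphere, mul_one, Real.norm_eq_abs,
      abs_of_pos (by linarith)]
    linarith

/-! ### The spliced concordance -/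

/-- **Splicing the trace of an ambient isotopy into the lower cone.** For a conical concordance
`f` from `K` to `K'` and an ambient isotopy `F` of `𝕊³` there are `ε > 0` (`ε ≤ δ/2`) and a
conical concordance `f'` of width `ε/2` from the moved knot `K.map (F.toDiffeomorph 1)` to `K'`
which agrees with `f` above radius `1 + ε` and is the trace cone `t • F_s (K x)` (some `s`)
below. [folklore] -/
theorem exists_splice_bottom :
    ∃ (ε : ℝ) (f' : (𝕊 1) × ℝ → 𝔼 4), 0 < ε ∧ ε ≤ δ / 2 ∧
      IsConicalConcordance (K.map (F.toDiffeomorph 1)) K' f' (ε / 2) ∧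
      (∀ (x : 𝕊 1) (t : ℝ), 1 + ε < t → f' (x, t) = f (x, t)) ∧
      ∀ (x : 𝕊 1) (t : ℝ), t ≤ 1 + ε → ∃ s : ℝ, f' (x, t) = t • ((F.toFun s (K x) : 𝕊 3) : 𝔼 4) := by
  have hδ := h.δ_pos
  have hδ4 := h.δ_le
  obtain ⟨m, hm, hmarg⟩ := h.exists_lower_margin
  set ε : ℝ := min (δ / 2) (m / 2) with hε
  have hεpos : 0 < ε := lt_min (by positivity) (by positivity)
  have hεδ : ε ≤ δ / 2 := min_le_left _ _
  have hεm : ε < m := (min_le_right _ _).trans_lt (by linarith)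
  have hεδ' : ε < δ := by linarith
  set G := h.spliceLift F ε with hG
  have hGs : ContDiff ℝ ∞ G := h.contDiff_spliceLift F hεpos hεδ'
  have hper : ∀ θ t, G (θ + 1, t) = G (θ, t) := h.spliceLift_add_one F ε
  -- values over angles
  have hval : ∀ u t, descend G (circlePt u, t) = G (u, t) := fun u t ↦ descend_circlePt hper u t
  -- radii
  have hnorm_le : ∀ u t, t ≤ 1 + ε → 0 ≤ t → ‖G (u, t)‖ = t := fun u t ht ht0 ↦
    h.norm_spliceLift_of_le F (q := (u, t)) ht ht0
  have hnorm_gt : ∀ u t, 1 + ε < t → t ≤ 2 → 1 + ε < ‖G (u, t)‖ := fun u t ht ht2 ↦ by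
    rw [hG, h.spliceLift_of_gt F (q := (u, t)) ht]
    exact h.lt_norm_annulusLift hεpos hεm hmarg ht
  -- injectivity of the lift modulo the period
  have hinjG : ∀ u t u' t', t ∈ Icc (1 : ℝ) 2 → t' ∈ Icc (1 : ℝ) 2 → G (u, t) = G (u', t') →
      t = t' ∧ ∃ k : ℤ, u' = u + k := by
    intro u t u' t' ht ht' he
    rcases le_or_gt t (1 + ε) with h1 | h1 <;> rcases le_or_gt t' (1 + ε) with h1' | h1'
    · have hn : t = t' := by
        rw [← hnorm_le u t h1 (by linarith [ht.1]), ← hnorm_le u' t' h1' (by linarith [ht'.1]), he]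
      subst hn
      refine ⟨rfl, ?_⟩
      rw [hG, h.spliceLift_of_le F (q := (u, t)) h1, h.spliceLift_of_le F (q := (u', t)) h1] at he
      have he' : h.movingCurve F ε (u, t) = h.movingCurve F ε (u', t) :=
        smul_right_injective _ (by simp only; linarith [ht.1]) he
      have he'' : F.toFun (spliceFn ε t) (K (circlePt u)) = F.toFun (spliceFn ε t) (K (circlePt u')) :=
        Subtype.ext he'
      have := K.injective ((F.bijective _).1 he'')
      obtain ⟨k, hk⟩ := circlePt_eq_circlePt_iff.1 this.symm
      exact ⟨k, hk⟩
    · exfalso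
      have e1 := hnorm_le u t h1 (by linarith [ht.1])
      have e2 := hnorm_gt u' t' h1' ht'.2
      rw [← he, e1] at e2; linarith
    · exfalso
      have e1 := hnorm_le u' t' h1' (by linarith [ht'.1])
      have e2 := hnorm_gt u t h1 ht.2
      rw [he, e1] at e2; linarith
    · rw [hG, h.spliceLift_of_gt F (q := (u, t)) h1, h.spliceLift_of_gt F (q := (u', t')) h1'] at he
      exact h.exists_int_of_F_eq ht ht' he
  -- injective differential of the lift on the thickened annulus
  have hderG : ∀ u t, t ∈ Icc (1 : ℝ) 2 → Injective (fderiv ℝ G (u, t)) := by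
    intro u t ht
    rcases lt_or_ge t (1 + δ) with h1 | h1
    · have hev : G =ᶠ[𝓝 (u, t)] fun q : ℝ × ℝ ↦ q.2 • h.movingCurve F ε q := by
        filter_upwards [(isOpen_lt continuous_snd continuous_const).mem_nhds (show (u, t).2 < 1 + δ from h1)]
          with q hq
        exact h.spliceLift_of_le_delta F hεpos (le_of_lt hq)
      rw [hev.fderiv_eq]
      exact injective_fderiv_cone_family ((h.contDiff_movingCurve F ε).of_le (by simp))
        (h.norm_movingCurve F ε) (h.fderiv_movingCurve_ne_zero F ε (u, t)) (by simp only; linarith [ht.1])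
    · have hev : G =ᶠ[𝓝 (u, t)] annulusLift f := by
        filter_upwards [(isOpen_lt continuous_const continuous_snd).mem_nhds
          (show 1 + ε < (u, t).2 by simp only; linarith)] with q hq
        exact h.spliceLift_of_gt F hq
      rw [hev.fderiv_eq]
      exact h.injective_fderiv_annulusLift u ⟨by linarith, by linarith [ht.2]⟩
  refine ⟨ε, descend G, hεpos, hεδ, ?_, ?_, ?_⟩
  · refine
      { isConcordance := ⟨contMDiff_descend hGs hper, ?_, ?_, ?_, ?_, ?_, ?_⟩
        δ_pos := by positivity
        δ_le := by linarith
        cone₁ := fun x t ht ↦ ?_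
        cone₂ := fun x t ht ↦ ?_ }
    · -- injectivity on the annulus
      rintro ⟨x, t⟩ ⟨-, ht⟩ ⟨x', t'⟩ ⟨-, ht'⟩ he
      rw [← circlePt_angA x, ← circlePt_angA x', hval, hval] at he
      obtain ⟨htt, k, hk⟩ := hinjG _ _ _ _ ht ht' he
      have hx : x' = x := by
        rw [← circlePt_angA x', hk]
        exact (circlePt_eq_circlePt_iff.2 ⟨k, rfl⟩).trans (circlePt_angA x)
      simp only at htt
      subst htt
      rw [hx]
    · -- immersion on the annulus
      rintro ⟨x, t⟩ ⟨-, ht⟩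
      exact mfderiv_descend_injective hGs hper fun u _ ↦ hderG u t ht
    · -- the open annulus goes into the open shell
      intro x t ht
      rw [← circlePt_angA x, hval]
      rcases le_or_gt t (1 + ε) with h1 | h1
      · rw [hnorm_le _ t h1 (by linarith [ht.1])]
        exact ⟨ht.1, by linarith [ht.2]⟩
      · rw [hG, h.spliceLift_of_gt F (q := (angA x, t)) h1, annulusLift_apply, circlePt_angA]
        exact h.isConcordance.2.2.2.1 x t ht
    · -- neatness
      intro x
      constructor
      · have hev : (fun t ↦ ‖descend G (x, t)‖ ^ 2) =ᶠ[𝓝 1] fun t ↦ t ^ 2 := by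
          filter_upwards [Ioo_mem_nhds (by norm_num : (0 : ℝ) < 1) (by linarith : (1 : ℝ) < 1 + ε)] with t ht
          rw [← circlePt_angA x, hval, hnorm_le _ t ht.2.le ht.1.le]
        rw [hev.deriv_eq]
        norm_num
      · have hev : (fun t ↦ ‖descend G (x, t)‖ ^ 2) =ᶠ[𝓝 2] fun t ↦ ‖f (x, t)‖ ^ 2 := by
          filter_upwards [Ioi_mem_nhds (by linarith : (1 : ℝ) + ε < 2)] with t ht
          rw [← circlePt_angA x, hval, hG, h.spliceLift_of_gt F (q := (angA x, t)) ht, annulusLift_apply,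
            circlePt_angA]
        rw [hev.deriv_eq]
        exact (h.isConcordance.2.2.2.2.1 x).2
    · -- the inner end is the moved knot
      intro x
      rw [← circlePt_angA x, hval, hG, h.spliceLift_of_le F (q := (angA x, 1)) (by simp only; linarith),
        one_smul, movingCurve, spliceFn_of_le hεpos (by simp only; linarith), circlePt_angA]
      rfl
    · -- the outer end
      intro x
      rw [← circlePt_angA x, hval, hG, h.spliceLift_of_gt F (q := (angA x, 2)) (by simp only; linarith),
        annulusLift_apply, circlePt_angA]
      exact h.isConcordance.2.2.2.2.2.2 x
    · -- the new lower cone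
      rw [← circlePt_angA x, hval, hG, h.spliceLift_of_le F (q := (angA x, t)) (by simp only; linarith),
        movingCurve, spliceFn_of_le hεpos (by simp only; linarith), circlePt_angA]
      rfl
    · -- the upper cone is the old one
      rw [← circlePt_angA x, hval, hG, h.spliceLift_of_gt F (q := (angA x, t)) (by simp only; linarith),
        annulusLift_apply, circlePt_angA]
      exact h.cone₂ x t (by linarith)
  · intro x t ht
    rw [← circlePt_angA x, hval, hG, h.spliceLift_of_gt F (q := (angA x, t)) ht, annulusLift_apply,
      circlePt_angA]
  · intro x t ht
    refine ⟨spliceFn ε t, ?_⟩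
    rw [← circlePt_angA x, hval, hG, h.spliceLift_of_le F (q := (angA x, t)) ht, movingCurve, circlePt_angA]

end IsConicalConcordance

end Knot

end Literature.Topology.FourManifolds
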